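import Literature.NumberTheory.EllipticCurves.Sprung2024.ChromaticSmallControl
import Literature.NumberTheory.EllipticCurves.Sprung2012.SharpFlatSelmerDualExistsProofs
import Literature.NumberTheory.EllipticCurves.IwasawaEulerCharDualityProofs
import Literature.NumberTheory.EllipticCurves.IwasawaSelmerControlAwayFromPProofs
import HarnessLib

/-!
# Sprung 2024, §5.2 Lemma 5.6 (♯/♭ Small Control, corollary form) PROVED modulo its `v = p`
# input: `Sel_{p^∞}(E/K)` finite ∧ (`r_𝔭` injective on the ♯/♭ condition) ⟹ `X^•/TX^•` finite

`Proofs` file (theorems only: **no definition, no named fact**; axioms standard) next to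
`Sprung2024/ChromaticSmallControl.lean`, whose two NAMED FACTS
`lem56_sharpFlat_finite_coinvariants_of_finite_selmer` / `lem56AllN_…` vendor F. Sprung, *On Iwasawa
main conjectures for elliptic curves at supersingular primes: beyond the case `a_p = 0`*, Adv. Math.
**449** (2024) 109741 [Sprung2024], §5.2 **Lemma 5.6 (Small Control Theorem)**, p. 41 (= preprint
arXiv:1610.10017, Lemma 4.7, p. 16) in the corollary form "`Sel_{p^∞}(E/ℚ)` finite ⟹ `X⋆/XX⋆` finite"
over the REAL chromatic objects of `Sprung2012/SharpFlatSelmer.lean`. Printed proof (p. 41): "The proof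
of [32, Theorem 9.3] with `n = 0` with the adjustment that `r_p` is injective (cf. Lemma 5.5) works"
— i.e. Kobayashi's control diagram (= Greenberg, LNM 1716, §3, the diagram of p. 85 with the snake
sequence `0 → ker s → ker h → ker g → coker s → coker h`, Lemmas 3.1–3.3) run for the chromatic Selmer
group, whose ONLY supersingular-specific input is the `v = p` clause in the proof of Lemma 5.5 (p. 40;
arXiv p. 15): "We want to show that the map
`H¹(ℚ_p, E[p^∞]) / E(ℚ_p) ⊗ ℚ_p/ℤ_p ⟶(r_p) H¹(ℚ_{p,∞}, E[p^∞]) / E^•_{∞,p}` is injective. … Taking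
Pontryagin duals, we see that `r_p` is injective, as claimed." (proved there from the specialisation
diagram of the Coleman maps, `(ker Col^•_p)_X → ker Col^•_{p,0}`, and [64, Lemma 2.3]).

THIS FILE PROVES Lemma 5.6 in the kernel from that one local input, taken as an explicit HYPOTHESIS
on the curve at hand (no `def … : Prop` is introduced here; the sibling statement file
`Sprung2024/ChromaticLocalInjectivity.lean` vendors the printed claim as the named fact
`lem55AllN_sharpFlat_localKerOver_of_layerToInfty_mem`, and the one-line composition
"`lem55AllN → lem56AllN`" lives with the consumer). Everything else in the printed proof is
reduction-type-free and is supplied by tree THEOREMS: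

* §1 (Pontryagin duality, the sentence "`X⋆/XX⋆` is finite if and only if …" read on the dual side):
  every `D : Sprung2012.SharpFlatSelmerDualData …` is a dual pair for `ψ = conj_γ − 1` on
  `Sel^•(E/K_∞)` (`SharpFlatSelmerDualData.isDualPair`, word for word the `±` twin
  `Kobayashi2003.SignedSelmerDualData.isDualPair`), whence
  `X^•/TX^• ≅ Hom(Sel^•(E/K_∞)^γ, ℚ/ℤ)` (tree `IwasawaDual.IsDualPair.exists_coinvariants_addEquiv`)
  and **`Finite (X^•/TX^•) ↔ Finite (Sel^•(E/K_∞)^γ)`** (`SharpFlatSelmerDualData.finite_coinvariants_iff`).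
* §2 (Greenberg's Lemma 3.2 = `coker h_0 = 0`, cocycle-level tree theorem
  `ZpExtension.mem_range_resOfLe_of_conjH1_eq`): `Sel^•(E/K_∞)^γ ⊆ h_0(A^•_0)` with
  `A^•_0 = h_0⁻¹(Sel^•(E/K_∞)) ⊆ H¹(K, E[p^∞])`, so `A^•_0` finite ⟹ `Sel^•(E/K_∞)^γ` finite
  (`finite_endInvariants_conjSharpFlatSelmerInfty_of_finite_comap`).
* §3 (the localisation step at `n = 0`, Greenberg p. 90 / Sprung's Lemma 5.5 away from `p`): for ANY
  subgroup `A' ⊆ A_0 = h_0⁻¹(Sel_{p^∞}(E/K_∞))` whose classes satisfy the classical local condition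
  at the places above `p` (THE HYPOTHESIS), `A' / Sel_{p^∞}(E/K_0)` is finite: the evaluation map
  `A' → ∏_{bad v ∤ p} H¹(K_v, E)` takes values in the finite groups `𝒦_{v,0}[p^∞]` (Greenberg's
  Lemma 3.3 at `n = 0`, tree theorem `finite_localTowerKerPrimary_zero_of_not_mem`) and its kernel
  lies in `Sel_0` (good `v ∤ p`: `localTowerKerPrimary_zero_eq_bot_of_hasGoodReductionAt`;
  archimedean: `ZpExtension.resGal_infinitePlace_mem_kerSubgroup`; above `p`: the hypothesis)
  (`WeierstrassCurve.finite_quotient_selmerLayer_zero_of_localResOver_eq_zero`).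
* §4 (assembly): `Sel_{p^∞}(E/K)` finite (`≃ Sel_0`, `nonempty_selmerLayer_zero_addEquiv`) and §3
  give `A^•_0` finite, then §2 and §1:
  `Sprung2024.finite_sharpFlat_coinvariants_of_finite_selmer_of_localResOver_eq_zero` (any number
  field, any `ℤ_p`-extension with topological generator, any embedding/colour/datum), and over `ℚ`
  in the binder shape of `lem56AllN_…` with the `v = p` input phrased EXACTLY as the body of the named
  fact of the sibling statement file:
  `Sprung2024.finite_sharpFlat_coinvariants_of_finite_selmer_of_sharpFlatLocalKummer_rat`.

The direction proved is the one the named facts state (and the one Lemma 5.7's printed proof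
consumes). HONEST FRAMING (cell `bsd-ssimc`, seat `bsd-ssimc-k3c5-kdot-split` g5, route K3 crux 5
`SprungLowerHalfAtThree`, support K2 = stmt-BirchSwinnertonDyer-19877): this turns the route's named
input "Lemma 5.6" into a kernel theorem modulo the single LOCAL statement at `p`; it asserts nothing
about any curve, moves no census cell, and BSD is not proved by any of this.

## References
* [Sprung2024] §5.2: Lemma 5.5 and its proof (p. 40), Lemma 5.6 and proof of Lemma 5.7 (p. 41);
  arXiv:1610.10017 §4, Lemmas 4.5–4.7 (pp. 15–16).
* [Kobayashi2003] S. Kobayashi, Invent. Math. 152 (2003), Thm. 9.3 (the control diagram).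
* [GreenbergLNM1716] R. Greenberg, LNM 1716 (1999), §3 pp. 85–90 (Lemmas 3.1–3.5), §1 p. 60.
* [Sprung2012] F. Sprung, J. Number Theory 132 (2012), Def. 7.9 / 7.11 (the objects), Lemma 2.3.

## Design
Theorems only; `noncomputable section`; `open scoped Classical`; one universe `u`. §1 declares
dot-notation extensions of the structure `Sprung2012.SharpFlatSelmerDualData` (sibling directory) by
absolute name; §3 is a deliberate dot-notation extension in `namespace WeierstrassCurve` (as the
`IwasawaSelmerControl*` files); the rest lives in `namespace Literature.NumberTheory.EllipticCurves.Sprung2024`.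
-/

noncomputable section

open scoped Classical NumberField

open NumberField IsDedekindDomain

universe u

/-! ## §1 Pontryagin duality for `X^•(E/K_∞)`: `Finite (X^•/TX^•) ↔ Finite (Sel^•(E/K_∞)^γ)` -/

namespace Literature.NumberTheory.EllipticCurves.Sprung2012

open Literature.NumberTheory.EllipticCurves Literature.NumberTheory.EllipticCurves.IwasawaAlgebra
  Literature.NumberTheory.EllipticCurves.IwasawaDual ZpExtension
  Literature.NumberTheory.EllipticCurves.Sprung2017

variable {K : Type u} [Field K] [NumberField K] {W : WeierstrassCurve K} {p : ℕ} [Fact p.Prime]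
  {κ : ZpExtension K p} {E : Type u} [Field E] [Algebra K E]
  {ι : AlgebraicClosure K →ₐ[K] AlgebraicClosure E} {ap : ℤ} {g : Field.absoluteGaloisGroup E}
  {c : ℕ → localPoints W E} {col : Chroma}

/-- `s ∈ Sel^•(E/K_∞)^γ = ker(conj_γ − 1)` iff `conj_γ s = s` in `H¹(K_∞, E[p^∞])`.
[cite: Sprung2012, Def. 7.11 (p. 1503)] -/
theorem mem_endInvariants_conjSharpFlatSelmerInfty_iff (γ : Field.absoluteGaloisGroup K)
    (s : sharpFlatSelmerInfty W κ ι ap g c col) :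
    s ∈ endInvariants (conjSharpFlatSelmerInfty W κ ι ap g c col γ - 1) ↔
      W.conjH1 p κ.kerSubgroup γ (s : W.subgroupH1 p κ.kerSubgroup) = s := by
  rw [mem_endInvariants_iff, End_sub_apply, AddMonoid.End.one_apply, sub_eq_zero,
    ← coe_conjSharpFlatSelmerInfty_apply]
  exact ⟨fun h ↦ congrArg Subtype.val h, fun h ↦ Subtype.ext h⟩

namespace SharpFlatSelmerDualData

/-- Every Pontryagin-dual datum `D : SharpFlatSelmerDualData W κ γ ι ap g c •` of `Sel^•(E/K_∞)` is a
dual pair for `ψ = conj_γ − 1` (`conjSharpFlatSelmerInfty`): `toDual_T_smul`, `toDual_C_smul`, and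
local nilpotence of `(p, ψ)` for a topological generator `γ`
(`isLocNil_conjSharpFlatSelmerInfty_sub_one`) — word for word the `±` twin
`Kobayashi2003.SignedSelmerDualData.isDualPair`. [cite: Sprung2012, Def. 7.11 (p. 1503) (the object `X^•`)]
[cite: GreenbergLNM1716, §1 p. 60 (after Conj. 1.3)] -/
theorem isDualPair {γ : Field.absoluteGaloisGroup K}
    (D : SharpFlatSelmerDualData W κ γ ι ap g c col) (hγ : κ.IsTopGenerator γ) :
    IwasawaDual.IsDualPair p (conjSharpFlatSelmerInfty W κ ι ap g c col γ - 1) D.toDual where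
  bijective := D.bijective
  T_smul x s := by
    rw [D.toDual_T_smul, IwasawaDual.End_sub_apply, AddMonoid.End.one_apply, map_sub]
    rfl
  C_smul a x s k hk := D.toDual_C_smul a x s k hk
  locNil := isLocNil_conjSharpFlatSelmerInfty_sub_one W κ ι ap g c col hγ

/-- **`X^•/TX^• ≅ Hom(Sel^•(E/K_∞)^γ, ℚ/ℤ)`** (Pontryagin duality for the chromatic dual datum; tree
`IsDualPair.exists_coinvariants_addEquiv`). [cite: Sprung2012, Def. 7.11 (p. 1503)]
[cite: GreenbergLNM1716, §1 pp. 60, 65] -/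
theorem exists_coinvariants_addEquiv {γ : Field.absoluteGaloisGroup K}
    (D : SharpFlatSelmerDualData W κ γ ι ap g c col) (hγ : κ.IsTopGenerator γ) :
    ∃ Ψ : coinvariants p D.X ≃+
        CharacterModule ↥(endInvariants (conjSharpFlatSelmerInfty W κ ι ap g c col γ - 1)),
      ∀ (x : D.X) (a : endInvariants (conjSharpFlatSelmerInfty W κ ι ap g c col γ - 1)),
        Ψ (Submodule.Quotient.mk x) a = D.toDual x a :=
  (D.isDualPair hγ).exists_coinvariants_addEquiv

/-- **`X^•/TX^•` is finite iff `Sel^•(E/K_∞)^γ` is** — the sentence of the printed proof of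
Lemma 5.7 ("`X⋆/XX⋆` is finite if and only if …", p. 41) on the `K_∞`-side of the duality, for every
number field, `ℤ_p`-extension, topological generator `γ`, embedding, colour and datum.
[cite: Sprung2024, §5.2 proof of Lemma 5.7 (p. 41)] [cite: GreenbergLNM1716, §1 pp. 60, 65] -/
theorem finite_coinvariants_iff {γ : Field.absoluteGaloisGroup K}
    (D : SharpFlatSelmerDualData W κ γ ι ap g c col) (hγ : κ.IsTopGenerator γ) :
    Finite (coinvariants p D.X) ↔
      Finite ↥(endInvariants (conjSharpFlatSelmerInfty W κ ι ap g c col γ - 1)) := by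
  obtain ⟨Ψ, -⟩ := D.exists_coinvariants_addEquiv hγ
  exact PontryaginCard.finite_iff_of_addEquiv_characterModule Ψ

end SharpFlatSelmerDualData

/-! ## §2 `Sel^•(E/K_∞)^γ ⊆ h_0(h_0⁻¹ Sel^•(E/K_∞))` (Greenberg's Lemma 3.2 at `n = 0`) -/

/-- **`A^•_0 = h_0⁻¹(Sel^•(E/K_∞))` finite ⟹ `Sel^•(E/K_∞)^γ` finite.** A class of `H¹(K_∞, E[p^∞])`
fixed by `conj_γ` (`γ` a topological generator) is a restriction from `H¹(K, E[p^∞])` — Greenberg's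
Lemma 3.2 "`Coker(h_n) = 0`" at `n = 0`, the cocycle-level tree theorem
`ZpExtension.mem_range_resOfLe_of_conjH1_eq` (`cd_p ℤ_p = 1`) — so `Sel^•(E/K_∞)^γ ↪ A^•_0` by a
choice of preimages. [cite: GreenbergLNM1716, §3 Lemma 3.2 (p. 86)] [cite: Sprung2024, §5.2 Lemma 5.6 (p. 41)] -/
theorem finite_endInvariants_conjSharpFlatSelmerInfty_of_finite_comap
    {γ : Field.absoluteGaloisGroup K} (hγ : κ.IsTopGenerator γ)
    (hA : Finite ↥((sharpFlatSelmerInfty W κ ι ap g c col).comap (W.layerToInfty κ 0))) :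
    Finite ↥(endInvariants (conjSharpFlatSelmerInfty W κ ι ap g c col γ - 1)) := by
  have hprim : ∀ m : W.geomPrimaryTorsion p, ∃ k : ℕ, p ^ k • m = 0 := fun m ↦ by
    obtain ⟨k, hk⟩ := m.2
    exact ⟨k, Subtype.ext (by rw [AddSubgroupClass.coe_nsmul, hk, ZeroMemClass.coe_zero])⟩
  -- every `γ`-fixed class of `Sel^•_∞` is `h_0 y` for some `y ∈ A^•_0`
  have hex : ∀ s : ↥(endInvariants (conjSharpFlatSelmerInfty W κ ι ap g c col γ - 1)),
      ∃ y : ↥((sharpFlatSelmerInfty W κ ι ap g c col).comap (W.layerToInfty κ 0)),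
        W.layerToInfty κ 0 (y : W.subgroupH1 p (κ.layerSubgroup 0)) =
          ((s : sharpFlatSelmerInfty W κ ι ap g c col) : W.subgroupH1 p κ.kerSubgroup) := by
    intro s
    have hfix := (mem_endInvariants_conjSharpFlatSelmerInfty_iff γ s.1).mp s.2
    have hfix' : conjH1 κ.kerSubgroup (W.geomPrimaryTorsion p) (γ ^ p ^ 0)
        ((s : sharpFlatSelmerInfty W κ ι ap g c col) : W.subgroupH1 p κ.kerSubgroup) =
          ((s : sharpFlatSelmerInfty W κ ι ap g c col) : W.subgroupH1 p κ.kerSubgroup) := by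
      rw [pow_zero, pow_one]; exact hfix
    obtain ⟨y, hy⟩ := ZpExtension.mem_range_resOfLe_of_conjH1_eq κ hγ 0
      (W.continuous_smul_geomPrimaryTorsion p) hprim _ hfix'
    have hyA : y ∈ (sharpFlatSelmerInfty W κ ι ap g c col).comap (W.layerToInfty κ 0) := by
      rw [AddSubgroup.mem_comap]
      change Literature.NumberTheory.EllipticCurves.resOfLe (W.geomPrimaryTorsion p)
        (κ.kerSubgroup_le_layerSubgroup 0) y ∈ sharpFlatSelmerInfty W κ ι ap g c col
      rw [hy]
      exact (s : sharpFlatSelmerInfty W κ ι ap g c col).2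
    exact ⟨⟨y, hyA⟩, hy⟩
  choose f hf using hex
  refine Finite.of_injective f fun s t hst ↦ ?_
  have h := hf s
  rw [hst, hf t] at h
  exact Subtype.ext (Subtype.ext h.symm)

end Literature.NumberTheory.EllipticCurves.Sprung2012

/-! ## §3 The localisation step at `n = 0` with the places above `p` as a hypothesis -/

namespace WeierstrassCurve

open Literature.NumberTheory.EllipticCurves Literature.NumberTheory.GaloisRepresentations

variable {K : Type u} [Field K] [NumberField K] (W : WeierstrassCurve K) {p : ℕ} [Fact p.Prime]
  (κ : ZpExtension K p)

/-- **`A' / Sel_{p^∞}(E/K_0)` is finite for every `A' ⊆ A_0 = h_0⁻¹(Sel_{p^∞}(E/K_∞))` whose classes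
satisfy the classical local condition at the places above `p`.** (Greenberg's proof of Lemma 3.5,
LNM 1716 p. 90, at the layer `n = 0`, with its `v ∣ p` input replaced by a hypothesis; for the
chromatic group `A' = h_0⁻¹(Sel^•(E/K_∞))` that hypothesis is Sprung's "`r_p` is injective",
Adv. Math. 449 (2024) p. 40.) Proof: the evaluation map `Φ : A' → ∏_{v ∈ S} H¹(K_v, E)`, `S` the
finite set of places of bad reduction not above `p` (`finite_badPlaces_holds`), takes values in the
finite groups `𝒦_{v,0}[p^∞]` (`localResOver_conjH1_mem_localTowerKer_of_mem`, classes are `p`-power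
torsion, Greenberg's Lemma 3.3 at `n = 0` = `finite_localTowerKerPrimary_zero_of_not_mem`), and
`ker Φ ⊆ Sel_0`: at layer `0` every `conj_σ` is the identity (`conjH1_of_mem`,
`ZpExtension.layerSubgroup_zero`), at good `v ∤ p` `𝒦_{v,0}[p^∞] = 0`
(`localTowerKerPrimary_zero_eq_bot_of_hasGoodReductionAt`), the archimedean places split completely
(`ZpExtension.resGal_infinitePlace_mem_kerSubgroup`, `localTowerKer_eq_bot_of_forall_mem`), and above
`p` the hypothesis applies. [cite: GreenbergLNM1716, §3 Lemma 3.5 (proof, p. 90) and Lemma 3.3 (pp. 86–87)]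
[cite: Sprung2024, §5.2 Lemma 5.5 (proof, p. 40)] -/
theorem finite_quotient_selmerLayer_zero_of_localResOver_eq_zero [W.IsElliptic]
    (A' : AddSubgroup (W.subgroupH1 p (κ.layerSubgroup 0)))
    (hA' : A' ≤ W.selmerInftyPreimage κ 0)
    (hp : ∀ v : HeightOneSpectrum (𝓞 K), (p : 𝓞 K) ∈ v.asIdeal → ∀ y ∈ A',
      W.localResOver p (κ.layerSubgroup 0) (v.adicCompletion K) y = 0) :
    Finite (↥A' ⧸ (W.selmerLayer κ 0).addSubgroupOf A') := by
  -- the finite set of bad places away from `p`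
  have hbad : (W.badPlaces (𝓞 K)).Finite := W.finite_badPlaces_holds (𝓞 K)
  let S : Finset (HeightOneSpectrum (𝓞 K)) :=
    hbad.toFinset.filter fun v ↦ (p : 𝓞 K) ∉ v.asIdeal
  have hS : ∀ v : HeightOneSpectrum (𝓞 K),
      v ∈ S ↔ ¬ W.HasGoodReductionAt v ∧ (p : 𝓞 K) ∉ v.asIdeal := fun v ↦ by
    simp only [S, Finset.mem_filter, Set.Finite.mem_toFinset, WeierstrassCurve.badPlaces,
      Set.mem_setOf_eq]
  -- at layer `0` every `conj_σ` is the identity (`Gal(K̄/K_0) = Γ_K`)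
  have hconj : ∀ (σ : Field.absoluteGaloisGroup K) (y : W.subgroupH1 p (κ.layerSubgroup 0)),
      W.conjH1 p (κ.layerSubgroup 0) σ y = y := fun σ y ↦ by
    rw [W.conjH1_of_mem_holds p (κ.layerSubgroup 0)
      (show σ ∈ κ.layerSubgroup 0 by rw [ZpExtension.layerSubgroup_zero]; trivial),
      AddMonoidHom.id_apply]
  -- for `y ∈ A' ⊆ A_0`, `loc_v y ∈ 𝒦_{v,0}[p^∞]` at every finite place
  have hprimary : ∀ (y : ↥A') (v : HeightOneSpectrum (𝓞 K)),
      W.localResOver p (κ.layerSubgroup 0) (v.adicCompletion K) (y : W.subgroupH1 p _) ∈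
        W.localTowerKerPrimary κ (v.adicCompletion K) 0 := by
    intro y v
    obtain ⟨k, hk⟩ := W.exists_pow_smul_subgroupH1_layer_eq_zero κ 0 (y : W.subgroupH1 p _)
    have hmem := W.localResOver_conjH1_mem_localTowerKer_of_mem κ (hA' y.2) v 1
    rw [hconj] at hmem
    exact ⟨hmem, k, by rw [← map_nsmul, hk, map_zero]⟩
  -- the evaluation map `Φ y = (loc_v y)_{v ∈ S}`
  let Φ : ↥A' →+ (Π v : ↥S, discreteH1 (localSubgroup (κ.layerSubgroup 0) (v.1.adicCompletion K))
      (localPoints W (v.1.adicCompletion K))) :=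
    AddMonoidHom.pi fun v ↦
      (W.localResOver p (κ.layerSubgroup 0) (v.1.adicCompletion K)).comp A'.subtype
  have hΦ : ∀ (y : ↥A') (v : ↥S), Φ y v = W.localResOver p (κ.layerSubgroup 0)
      (v.1.adicCompletion K) (y : W.subgroupH1 p _) :=
    fun y v ↦ rfl
  -- `ker Φ ⊆ Sel_0`
  have hker : Φ.ker ≤ (W.selmerLayer κ 0).addSubgroupOf A' := by
    intro y hy
    rw [AddSubgroup.mem_addSubgroupOf]
    change (y : W.subgroupH1 p (κ.layerSubgroup 0)) ∈ W.selmerGroupOver p (κ.layerSubgroup 0)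
    rw [mem_selmerGroupOver_iff]
    refine ⟨fun v σ ↦ ?_, fun w σ ↦ ?_⟩
    · rw [hconj, mem_localKerOver_iff]
      by_cases hpv : (p : 𝓞 K) ∈ v.asIdeal
      · exact hp v hpv _ y.2
      · by_cases hgood : W.HasGoodReductionAt v
        · have hmem := hprimary y v
          rw [W.localTowerKerPrimary_zero_eq_bot_of_hasGoodReductionAt κ v hpv hgood,
            AddSubgroup.mem_bot] at hmem
          exact hmem
        · have hvS : v ∈ S := (hS v).mpr ⟨hgood, hpv⟩
          have := congrFun ((AddMonoidHom.mem_ker).mp hy) ⟨v, hvS⟩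
          rw [hΦ] at this
          exact this
    · rw [hconj, mem_localKerOver_iff]
      have hmem := W.localResOver_conjH1_mem_localTowerKer_of_mem_infinitePlace κ (hA' y.2) w 1
      rw [hconj, W.localTowerKer_eq_bot_of_forall_mem κ w.Completion 0
        (κ.resGal_infinitePlace_mem_kerSubgroup w), AddSubgroup.mem_bot] at hmem
      exact hmem
  -- the values of `Φ` lie in the finite group `∏_{v ∈ S} 𝒦_{v,0}[p^∞]`
  haveI hfin : ∀ v : ↥S, Finite (W.localTowerKerPrimary κ (v.1.adicCompletion K) 0) :=
    fun v ↦ W.finite_localTowerKerPrimary_zero_of_not_mem κ ((hS v.1).mp v.2).2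
  let gΦ : Φ.range → Π v : ↥S, ↥(W.localTowerKerPrimary κ (v.1.adicCompletion K) 0) :=
    fun x v ↦ ⟨x.1 v, by obtain ⟨y, hy⟩ := x.2; rw [← hy]; exact hprimary y v.1⟩
  have hg : Function.Injective gΦ := by
    rintro ⟨x, hx⟩ ⟨x', hx'⟩ h
    refine Subtype.ext (funext fun v ↦ ?_)
    have := congrFun h v
    simpa [gΦ] using this
  haveI : Finite Φ.range := Finite.of_injective gΦ hg
  haveI : Finite (↥A' ⧸ Φ.ker) :=
    Finite.of_equiv _ (QuotientAddGroup.quotientKerEquivRange Φ).toEquiv.symm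
  -- `A' ⧸ ker Φ ↠ A' ⧸ Sel_0`
  let π : ↥A' ⧸ Φ.ker →+ ↥A' ⧸ (W.selmerLayer κ 0).addSubgroupOf A' :=
    QuotientAddGroup.map Φ.ker ((W.selmerLayer κ 0).addSubgroupOf A') (AddMonoidHom.id _)
      (by rwa [AddSubgroup.comap_id])
  have hπ : Function.Surjective π := by
    intro q
    induction q using QuotientAddGroup.induction_on with
    | H a => exact ⟨QuotientAddGroup.mk a, rfl⟩
  exact Finite.of_surjective π hπ

/-- **`A'` itself is finite** under the hypotheses of
`finite_quotient_selmerLayer_zero_of_localResOver_eq_zero` when moreover `Sel_{p^∞}(E/K)` is finite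
(`Sel_0 ≃ Sel_{p^∞}(E/K)`, `nonempty_selmerLayer_zero_addEquiv`): `A' ∩ Sel_0 ↪ Sel_0` and
`#A' = #(A'/(A' ∩ Sel_0)) · #(A' ∩ Sel_0)`. [cite: GreenbergLNM1716, §3 p. 90 and §1 p. 60]
[cite: Sprung2024, §5.2 Lemma 5.6 (p. 41)] -/
theorem finite_of_le_selmerInftyPreimage_zero_of_localResOver_eq_zero [W.IsElliptic]
    (A' : AddSubgroup (W.subgroupH1 p (κ.layerSubgroup 0)))
    (hA' : A' ≤ W.selmerInftyPreimage κ 0)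
    (hp : ∀ v : HeightOneSpectrum (𝓞 K), (p : 𝓞 K) ∈ v.asIdeal → ∀ y ∈ A',
      W.localResOver p (κ.layerSubgroup 0) (v.adicCompletion K) y = 0)
    (hfin : Finite (W.selmerGroupPInfty p)) : Finite ↥A' := by
  haveI := hfin
  haveI hq := W.finite_quotient_selmerLayer_zero_of_localResOver_eq_zero κ A' hA' hp
  -- `Sel_0` is finite
  obtain ⟨e⟩ := W.nonempty_selmerLayer_zero_addEquiv κ (p := p)
  haveI : Finite ↥(W.selmerLayer κ 0) := Finite.of_equiv _ e.toEquiv.symm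
  -- `A' ∩ Sel_0` is finite
  haveI hN : Finite ↥((W.selmerLayer κ 0).addSubgroupOf A') := by
    let f : ↥((W.selmerLayer κ 0).addSubgroupOf A') → ↥(W.selmerLayer κ 0) := fun x ↦
      ⟨((x : ↥A') : W.subgroupH1 p (κ.layerSubgroup 0)), AddSubgroup.mem_addSubgroupOf.mp x.2⟩
    have hf : ∀ x, ((f x : ↥(W.selmerLayer κ 0)) : W.subgroupH1 p (κ.layerSubgroup 0)) =
        ((x : ↥A') : W.subgroupH1 p (κ.layerSubgroup 0)) := fun _ ↦ rfl
    refine Finite.of_injective f fun x y hxy ↦ ?_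
    have h := congrArg (fun z : ↥(W.selmerLayer κ 0) ↦ (z : W.subgroupH1 p (κ.layerSubgroup 0))) hxy
    simp only [hf] at h
    exact Subtype.ext (Subtype.ext h)
  -- extension of finite by finite
  have hcard := AddSubgroup.card_eq_card_quotient_mul_card_addSubgroup
    ((W.selmerLayer κ 0).addSubgroupOf A')
  refine Nat.finite_of_card_ne_zero ?_
  rw [hcard]
  exact mul_ne_zero Nat.card_pos.ne' Nat.card_pos.ne'

end WeierstrassCurve

/-! ## §4 Lemma 5.6 (corollary form) from the local input at the places above `p` -/

namespace Literature.NumberTheory.EllipticCurves.Sprung2024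

open Literature.NumberTheory.EllipticCurves Literature.NumberTheory.EllipticCurves.IwasawaAlgebra
  Literature.NumberTheory.EllipticCurves.IwasawaDual WeierstrassCurve ZpExtension
  Literature.NumberTheory.EllipticCurves.Sprung2017 Literature.NumberTheory.EllipticCurves.Sprung2012

section General

variable {K : Type u} [Field K] [NumberField K] (W : WeierstrassCurve K) {p : ℕ} [Fact p.Prime]
  (κ : ZpExtension K p) {E : Type u} [Field E] [Algebra K E]
  (ι : AlgebraicClosure K →ₐ[K] AlgebraicClosure E) (ap : ℤ) (g : Field.absoluteGaloisGroup E)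
  (c : ℕ → localPoints W E) (col : Chroma)

/-- `A^•_0 = h_0⁻¹(Sel^•(E/K_∞)) ⊆ A_0 = h_0⁻¹(Sel_{p^∞}(E/K_∞))` (`Sel^• ≤ Sel`).
[cite: Sprung2012, Def. 7.11 (p. 1503)] -/
theorem comap_layerToInfty_sharpFlatSelmerInfty_le_selmerInftyPreimage :
    (sharpFlatSelmerInfty W κ ι ap g c col).comap (W.layerToInfty κ 0) ≤
      W.selmerInftyPreimage κ 0 :=
  fun _ hy ↦ sharpFlatSelmerInfty_le_selmerInfty W κ ι ap g c col (AddSubgroup.mem_comap.mp hy)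

/-- **Sprung 2024, Lemma 5.6 (Small Control Theorem, corollary form), PROVED modulo its `v ∣ p`
input — general form.** Let `K` be a number field, `E/K` elliptic, `κ` any `ℤ_p`-extension with
topological generator `γ`, `Sel^•(E/K_∞)` the chromatic Selmer group attached to
`(ι, ap, g, c, •)` and `D` any Pontryagin-dual datum (`X^• = D.X`, `T = γ − 1`). IF every class
`y ∈ H¹(K, E[p^∞])` whose restriction `h_0 y` lies in `Sel^•(E/K_∞)` satisfies the classical local
condition at every place above `p` (for `K = ℚ`: Sprung's "`r_p` is injective", proof of Lemma 5.5,
p. 40), and `Sel_{p^∞}(E/K)` is finite, THEN `X^•/TX^•` is finite. Chain: §3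
(`finite_of_le_selmerInftyPreimage_zero_of_localResOver_eq_zero` for `A' = h_0⁻¹(Sel^•_∞)`) ⟹
`A^•_0` finite ⟹ §2 `Sel^•(E/K_∞)^γ` finite ⟹ §1 `X^•/TX^•` finite.
[cite: Sprung2024, §5.2 Lemma 5.6 (p. 41) and proof of Lemma 5.5 (p. 40)]
[cite: Kobayashi2003, Thm. 9.3] [cite: GreenbergLNM1716, §3 pp. 85–90] -/
theorem finite_sharpFlat_coinvariants_of_finite_selmer_of_localResOver_eq_zero [W.IsElliptic]
    {γ : Field.absoluteGaloisGroup K} (hγ : κ.IsTopGenerator γ)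
    (D : SharpFlatSelmerDualData W κ γ ι ap g c col)
    (hp : ∀ v : HeightOneSpectrum (𝓞 K), (p : 𝓞 K) ∈ v.asIdeal →
      ∀ y : W.subgroupH1 p (κ.layerSubgroup 0),
        W.layerToInfty κ 0 y ∈ sharpFlatSelmerInfty W κ ι ap g c col →
        W.localResOver p (κ.layerSubgroup 0) (v.adicCompletion K) y = 0)
    (hfin : Finite (W.selmerGroupPInfty p)) :
    Finite (coinvariants p D.X) := by
  rw [D.finite_coinvariants_iff hγ]
  refine finite_endInvariants_conjSharpFlatSelmerInfty_of_finite_comap hγ ?_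
  exact W.finite_of_le_selmerInftyPreimage_zero_of_localResOver_eq_zero κ _
    (comap_layerToInfty_sharpFlatSelmerInfty_le_selmerInftyPreimage W κ ι ap g c col)
    (fun v hv y hy ↦ hp v hv y (AddSubgroup.mem_comap.mp hy)) hfin

end General

/-! ### Over `ℚ`, in the binder shape of `lem56AllN_…`, with the `v = p` input in named-fact shape -/

/-- Places of `ℚ` containing the same rational prime coincide (`𝓞 ℚ ≃ ℤ`). [folklore] -/
private theorem heightOneSpectrum_rat_eq_of_natCast_mem {ℓ : ℕ} (hℓ : ℓ.Prime)
    {v v' : HeightOneSpectrum (𝓞 ℚ)} (hv : (ℓ : 𝓞 ℚ) ∈ v.asIdeal)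
    (hv' : (ℓ : 𝓞 ℚ) ∈ v'.asIdeal) : v = v' := by
  have hprime : Prime (ℓ : 𝓞 ℚ) := by
    rw [← MulEquiv.prime_iff (Rat.ringOfIntegersEquiv : 𝓞 ℚ ≃+* ℤ).toMulEquiv]
    change Prime (Rat.ringOfIntegersEquiv (ℓ : 𝓞 ℚ))
    rw [map_natCast, ← Nat.prime_iff_prime_int]
    exact hℓ
  have hmax : (Ideal.span {(ℓ : 𝓞 ℚ)}).IsMaximal :=
    ((Ideal.span_singleton_prime hprime.ne_zero).mpr hprime).isMaximal
      (by rw [Ne, Ideal.span_singleton_eq_bot]; exact hprime.ne_zero)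
  have key : ∀ u : HeightOneSpectrum (𝓞 ℚ), (ℓ : 𝓞 ℚ) ∈ u.asIdeal →
      Ideal.span {(ℓ : 𝓞 ℚ)} = u.asIdeal := fun u hu ↦
    hmax.eq_of_le u.isPrime.ne_top ((Ideal.span_singleton_le_iff_mem _).mpr hu)
  exact HeightOneSpectrum.ext (by rw [← key v hv, key v' hv'])

/-- **Sprung 2024, Lemma 5.6 (corollary form) over `ℚ` from the `v = p` clause of the proof of
Lemma 5.5, in the binder shape of `lem56AllN_sharpFlat_finite_coinvariants_of_finite_selmer`.**
For `W/ℚ` elliptic, any prime `p`, any `ℤ_p`-extension `κ` with topological generator `γ`, the place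
`v ∋ p`, the chosen embedding `K̄ → K̄_v`, local data `(g, c)`, a colour `•` and a datum `D` of
`Sel^•(E/ℚ_∞)`: IF every class `y ∈ H¹(ℚ, E[p^∞])` whose restriction to `ℚ_∞` satisfies the
`•`-condition at `𝔭` (`h_0 y ∈ sharpFlatLocalKummerOverOfEmb … (colemanKer …)`, i.e.
`loc_𝔭(res y) ∈ E^•_{∞,𝔭}`) satisfies the classical local condition at `p`
(`y ∈ localKerOver`, i.e. `loc_p y ∈ E(ℚ_p) ⊗ ℚ_p/ℤ_p`) — Sprung's "`r_p` is injective" (p. 40) on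
the classes coming from `H¹(ℚ, E[p^∞])`, EXACTLY the body of the named fact
`lem55AllN_sharpFlat_localKerOver_of_layerToInfty_mem` of `Sprung2024/ChromaticLocalInjectivity.lean`
at `(W, p, κ, v, g, c, •)` — and `Sel_{p^∞}(E/ℚ)` is finite, THEN `X^•/TX^•`
(`IwasawaAlgebra.coinvariants p D.X`) is finite. (Over `ℚ` the place above `p` is unique, so the
hypothesis at `v` covers every place above `p`; the `•`-condition at `𝔭` is the `σ = 1` instance of
`mem_sharpFlatSelmerInfty_iff`.) No reduction, conductor, parity or `a_p` hypothesis is used.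
[cite: Sprung2024, §5.2 Lemma 5.6 (p. 41) and proof of Lemma 5.5 (p. 40)]
[cite: Kobayashi2003, Thm. 9.3] [cite: GreenbergLNM1716, §3 pp. 85–90] -/
theorem finite_sharpFlat_coinvariants_of_finite_selmer_of_sharpFlatLocalKummer_rat
    (W : WeierstrassCurve ℚ) [W.IsElliptic] [W.IsGloballyMinimal] (p : ℕ) [Fact p.Prime]
    (κ : ZpExtension ℚ p) {γ : Field.absoluteGaloisGroup ℚ} (hγ : κ.IsTopGenerator γ)
    (v : HeightOneSpectrum (𝓞 ℚ)) (hv : (p : 𝓞 ℚ) ∈ v.asIdeal)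
    (g : Field.absoluteGaloisGroup (v.adicCompletion ℚ))
    (c : ℕ → localPoints W (v.adicCompletion ℚ)) (col : Chroma)
    (D : SharpFlatSelmerDualData W κ γ (closureEmb (K := ℚ) (v.adicCompletion ℚ))
      (W.frobeniusTrace p) g c col)
    (hloc : ∀ y : W.subgroupH1 p (κ.layerSubgroup 0),
      W.layerToInfty κ 0 y ∈ sharpFlatLocalKummerOverOfEmb W p κ.kerSubgroup
          (closureEmb (K := ℚ) (v.adicCompletion ℚ))
          (localTowerPointsOfEmb κ (closureEmb (K := ℚ) (v.adicCompletion ℚ)) W)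
          (colemanKer κ (closureEmb (K := ℚ) (v.adicCompletion ℚ)) W (W.frobeniusTrace p) g c col) →
        y ∈ W.localKerOver p (κ.layerSubgroup 0) (v.adicCompletion ℚ))
    (hfin : Finite (W.selmerGroupPInfty p)) :
    Finite (coinvariants p D.X) := by
  refine finite_sharpFlat_coinvariants_of_finite_selmer_of_localResOver_eq_zero W κ
    (closureEmb (K := ℚ) (v.adicCompletion ℚ)) (W.frobeniusTrace p) g c col hγ D
    (fun v' hv' y hy ↦ ?_) hfin
  obtain rfl : v = v' := heightOneSpectrum_rat_eq_of_natCast_mem (Fact.out : p.Prime) hv hv'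
  have h1 := ((mem_sharpFlatSelmerInfty_iff W κ (closureEmb (K := ℚ) (v.adicCompletion ℚ))
    (W.frobeniusTrace p) g c col _).mp hy).2 1
  rw [W.conjH1_one_holds p κ.kerSubgroup, AddMonoidHom.id_apply] at h1
  exact (W.mem_localKerOver_iff p (κ.layerSubgroup 0) (v.adicCompletion ℚ) y).mp (hloc y h1)

end Literature.NumberTheory.EllipticCurves.Sprung2024

end
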